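import Literature.AlgebraicTopology.Homotopy.UniformLocalContractibility
import Literature.Topology.Euclidean.LatticeCubeFaces
import Mathlib.Topology.UniformSpace.UniformConvergenceTopology
import HarnessLib

/-!
# Filling a lattice face from boundary data by a local contraction

Topic `Literature/AlgebraicTopology/Homotopy`. The cell-filling step of Hatcher's proof of
Thm. A.7 (*Algebraic Topology* (2002), p. 527: "if the restriction of `r` to this boundary
extends over `e^{k+1}` then … let `r` on `e^{k+1}` be such an extension"), in the uniform form:
if the boundary `∂F` of a lattice face `F` of `h ℤᴺ` (`LatticeCubeFaces.lean`) is mapped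
continuously into `K ∩ closedBall a δ`, and `K ∩ closedBall a δ` contracts inside `K ∩ ball a ε`
(`BallContraction K a δ ε`, `UniformLocalContractibility.lean`), then the map extends
continuously over the closed face `F` with values in `K ∩ ball a ε` — cone off the boundary
values along the contraction, in the cube coordinates `coord`/`param` of the face.

* `tendsto_uniformly_of_compact` (tube lemma, metric form): a homotopy continuous on
  `S × [0, 1]`, `S` compact, ending at the constant `c`, is uniformly close to `c` near `t = 1`;
* `exists_lcFill`: the extension.

No `sorry`; [folklore].

## References

* A. Hatcher, *Algebraic Topology*, CUP (2002), Appendix, proof of Thm. A.7 (p. 527).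
  [HatcherAT2002]
-/

noncomputable section

open Set Metric Topology Filter Function
open Literature.Topology.Euclidean

namespace Literature.AlgebraicTopology.Homotopy

/-! ### A uniform (tube-lemma) estimate near the end of a homotopy -/

/-- **Near `t = 1` a homotopy on a compact set is uniformly close to its constant end.**
[folklore] -/
theorem tendsto_uniformly_of_compact {X Y : Type*} [MetricSpace X] [MetricSpace Y] {S : Set X}
    (hS : IsCompact S) {G : X × ℝ → Y} (hG : ContinuousOn G (S ×ˢ Icc 0 1)) {c : Y}
    (hc : ∀ v ∈ S, G (v, 1) = c) {ε : ℝ} (hε : 0 < ε) :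
    ∃ θ > 0, ∀ v ∈ S, ∀ t ∈ Icc (0 : ℝ) 1, 1 - θ < t → dist (G (v, t)) c < ε := by
  have hunif := (hS.prod (isCompact_Icc (a := (0 : ℝ)) (b := 1))).uniformContinuousOn_of_continuous hG
  obtain ⟨θ, hθ, hθε⟩ := Metric.uniformContinuousOn_iff.1 hunif ε hε
  refine ⟨θ, hθ, fun v hv t ht h1t => ?_⟩
  have h1 : ((v, (1 : ℝ)) : X × ℝ) ∈ S ×ˢ Icc (0 : ℝ) 1 := ⟨hv, ⟨zero_le_one, le_rfl⟩⟩
  have h2 : dist ((v, t) : X × ℝ) (v, 1) < θ := by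
    rw [Prod.dist_eq, dist_self, Real.dist_eq, max_lt_iff]
    exact ⟨hθ, by rw [abs_lt]; constructor <;> linarith [ht.2]⟩
  have := hθε (v, t) ⟨hv, ht⟩ (v, 1) h1 h2
  rwa [hc v hv] at this

/-! ### The fill -/

namespace LatticeCubeFill

open LatticeCube

variable {N : ℕ} {h : ℝ}

/-- Normalising a nonzero vector of `Fin k → ℝ` lands on the unit sphere. [folklore] -/
theorem inv_norm_smul_mem_sphere {k : ℕ} {w : Fin k → ℝ} (hw : w ≠ 0) :
    ‖w‖⁻¹ • w ∈ sphere (0 : Fin k → ℝ) 1 := by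
  rw [mem_sphere_zero_iff_norm, norm_smul, norm_inv, norm_norm,
    inv_mul_cancel₀ (norm_ne_zero_iff.2 hw)]

end LatticeCubeFill

open LatticeCube in
/-- **Filling a lattice face from its boundary by a local contraction** (the cell step of
Hatcher's proof of Thm. A.7): if `b` maps `∂F = F ∖ relint F` continuously into
`K ∩ closedBall a δ` and `K ∩ closedBall a δ` contracts in `K ∩ ball a ε`, then there is `g`,
continuous on the closed face `F` (of dimension `≥ 1`), equal to `b` on `∂F`, with values in
`K ∩ ball a ε`. [cite: HatcherAT2002, Thm. A.7 (proof)] -/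
theorem exists_lcFill {N : ℕ} {h : ℝ} (hh : 0 < h) (F : Face N) {k : ℕ}
    (hk : F.S.card = k) (hk1 : 1 ≤ k) {K : Set (Fin N → ℝ)} {a : Fin N → ℝ} {δ ε : ℝ}
    (B : BallContraction K a δ ε) {b : (Fin N → ℝ) → (Fin N → ℝ)}
    (hb : ContinuousOn b (F.carrier h \ F.relint h))
    (hbK : MapsTo b (F.carrier h \ F.relint h) (K ∩ closedBall a δ)) :
    ∃ g : (Fin N → ℝ) → (Fin N → ℝ), ContinuousOn g (F.carrier h) ∧
      EqOn g b (F.carrier h \ F.relint h) ∧ MapsTo g (F.carrier h) (K ∩ ball a ε) := by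
  classical
  -- notation
  set bd : Set (Fin N → ℝ) := F.carrier h \ F.relint h with hbd
  have hbdc : IsCompact bd := by
    refine (isCompact_of_isClosed_isBounded ?_ ?_)
    · -- `bd = coord ⁻¹' sphere ∩ carrier` is closed: use `param '' sphere`
      have : bd = F.param h hk '' sphere 0 1 := by
        ext y
        constructor
        · rintro ⟨hy, hy'⟩
          refine ⟨F.coord h hk y, mem_sphere_zero_iff_norm.2
            (F.norm_coord_eq_one_of_not_mem_relint hh hk hy hy'), Face.param_coord hh hy⟩
        · rintro ⟨w, hw, rfl⟩
          refine ⟨Face.param_mem_carrier hh w, fun hr => ?_⟩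
          have := (F.param_mem_relint_iff hh hk (sphere_subset_closedBall hw)).1 hr
          rw [mem_ball_zero_iff] at this
          exact absurd (mem_sphere_zero_iff_norm.1 hw) (ne_of_lt this)
      rw [this]
      exact ((isCompact_sphere _ _).image Face.continuous_param).isClosed
    · exact (isCompact_carrier_top F.a).isBounded.subset
        (sdiff_subset.trans (F.carrier_subset_carrier_top hh.le
          (fun _ => ⟨fun _ => rfl, fun _ => Or.inl rfl⟩)))
  -- the sphere goes to the boundary
  have hps : ∀ w ∈ sphere (0 : Fin k → ℝ) 1, F.param h hk w ∈ bd := by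
    intro w hw
    refine ⟨Face.param_mem_carrier hh w, fun hr => ?_⟩
    have := (F.param_mem_relint_iff hh hk (sphere_subset_closedBall hw)).1 hr
    rw [mem_ball_zero_iff] at this
    exact absurd (mem_sphere_zero_iff_norm.1 hw) (ne_of_lt this)
  -- the fill
  let g : (Fin N → ℝ) → (Fin N → ℝ) := fun y =>
    if F.coord h hk y = 0 then B.c
    else B.G (b (F.param h hk (‖F.coord h hk y‖⁻¹ • F.coord h hk y)), 1 - ‖F.coord h hk y‖)
  -- the end point lies in the target (the boundary is nonempty as `k ≥ 1`)
  obtain ⟨w₁, hw₁⟩ : ∃ w : Fin k → ℝ, w ∈ sphere (0 : Fin k → ℝ) 1 := by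
    refine ⟨fun _ => 1, ?_⟩
    rw [mem_sphere_zero_iff_norm]
    haveI : Nonempty (Fin k) := ⟨⟨0, hk1⟩⟩
    simp [Pi.norm_def, Finset.sup_const Finset.univ_nonempty]
  have hcmem : B.c ∈ K ∩ ball a ε := by
    have h1 := hbK (hps w₁ hw₁)
    rw [← B.G_one _ h1]
    exact B.G_mem _ h1 1 ⟨zero_le_one, le_rfl⟩
  -- values off the centre
  have hval : ∀ y ∈ F.carrier h, F.coord h hk y ≠ 0 →
      b (F.param h hk (‖F.coord h hk y‖⁻¹ • F.coord h hk y)) ∈ K ∩ closedBall a δ ∧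
      (1 - ‖F.coord h hk y‖) ∈ Icc (0 : ℝ) 1 := by
    intro y hy hw
    refine ⟨hbK (hps _ (LatticeCubeFill.inv_norm_smul_mem_sphere hw)), ?_⟩
    have h1 := mem_closedBall_zero_iff.1 (Face.coord_mem_closedBall (F := F) (hk := hk) hh hy)
    exact ⟨by linarith, by linarith [norm_nonneg (F.coord h hk y)]⟩
  refine ⟨g, ?_, ?_, ?_⟩
  · -- continuity on the closed face
    intro y hy
    by_cases hw : F.coord h hk y = 0
    · -- at the centre: uniform estimate near `t = 1`
      have hgy : g y = B.c := by simp [g, hw]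
      rw [ContinuousWithinAt, hgy, Metric.tendsto_nhds]
      intro ε' hε'
      have hSc : IsCompact (b '' bd) := hbdc.image_of_continuousOn hb
      obtain ⟨θ, hθ, hθε⟩ := tendsto_uniformly_of_compact hSc
        (B.continuousOn.mono (prod_mono (by rintro _ ⟨y, hy, rfl⟩; exact hbK hy) Subset.rfl))
        (fun v hv => by obtain ⟨y', hy', rfl⟩ := hv; exact B.G_one _ (hbK hy')) hε'
      -- points with `‖coord‖ < θ` are fine
      have hopen : {y' : Fin N → ℝ | ‖F.coord h hk y'‖ < θ} ∈ 𝓝 y := by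
        refine (isOpen_lt (continuous_norm.comp Face.continuous_coord) continuous_const).mem_nhds ?_
        show ‖F.coord h hk y‖ < θ
        rw [hw, norm_zero]; exact hθ
      filter_upwards [mem_nhdsWithin_of_mem_nhds hopen, self_mem_nhdsWithin] with y' hy' hy'F
      by_cases hw' : F.coord h hk y' = 0
      · have : g y' = B.c := by simp [g, hw']
        rw [this, dist_self]; exact hε'
      · have hgy' : g y' = B.G (b (F.param h hk (‖F.coord h hk y'‖⁻¹ • F.coord h hk y')),
            1 - ‖F.coord h hk y'‖) := by simp [g, hw']
        rw [hgy']
        obtain ⟨h1, h2⟩ := hval y' hy'F hw'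
        refine hθε _ ⟨_, hps _ (LatticeCubeFill.inv_norm_smul_mem_sphere hw'), rfl⟩ _ h2 ?_
        have : ‖F.coord h hk y'‖ < θ := hy'
        linarith
    · -- off the centre: restrict to the open set `{coord ≠ 0}` and compose
      set T : Set (Fin N → ℝ) := F.carrier h ∩ {y' | F.coord h hk y' ≠ 0} with hT
      have hTmem : T ∈ 𝓝[F.carrier h] y :=
        inter_mem self_mem_nhdsWithin (mem_nhdsWithin_of_mem_nhds
          ((isOpen_ne.preimage Face.continuous_coord).mem_nhds hw))
      refine ContinuousWithinAt.mono_of_mem_nhdsWithin ?_ hTmem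
      have hcoord : ContinuousWithinAt (F.coord h hk) T y :=
        Face.continuous_coord.continuousWithinAt
      have hdir : ContinuousWithinAt (fun y' => ‖F.coord h hk y'‖⁻¹ • F.coord h hk y') T y :=
        ((continuous_norm.continuousAt.comp_continuousWithinAt hcoord).inv₀
          (norm_ne_zero_iff.2 hw)).smul hcoord
      have hpd : ContinuousWithinAt (fun y' => F.param h hk (‖F.coord h hk y'‖⁻¹ • F.coord h hk y'))
          T y := Face.continuous_param.continuousAt.comp_continuousWithinAt hdir
      have hin₁ : ContinuousWithinAt
          (fun y' => b (F.param h hk (‖F.coord h hk y'‖⁻¹ • F.coord h hk y'))) T y :=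
        ContinuousWithinAt.comp (hb _ (hps _ (LatticeCubeFill.inv_norm_smul_mem_sphere hw))) hpd
          fun y' hy' => hps _ (LatticeCubeFill.inv_norm_smul_mem_sphere hy'.2)
      have hin₂ : ContinuousWithinAt (fun y' => 1 - ‖F.coord h hk y'‖) T y :=
        continuousWithinAt_const.sub (continuous_norm.continuousAt.comp_continuousWithinAt hcoord)
      have hcomp : ContinuousWithinAt (fun y' => B.G (b (F.param h hk
          (‖F.coord h hk y'‖⁻¹ • F.coord h hk y')), 1 - ‖F.coord h hk y'‖)) T y := by
        refine ContinuousWithinAt.comp (B.continuousOn _ ⟨(hval y hy hw).1, (hval y hy hw).2⟩)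
          (hin₁.prodMk hin₂) fun y' hy' => ⟨(hval y' hy'.1 hy'.2).1, (hval y' hy'.1 hy'.2).2⟩
      refine hcomp.congr (fun y' hy' => ?_) ?_
      · have hw' : F.coord h hk y' ≠ 0 := hy'.2
        show g y' = _
        simp [g, hw']
      · show g y = _
        simp [g, hw]
  · -- boundary values
    intro y hy
    have h1 : ‖F.coord h hk y‖ = 1 := F.norm_coord_eq_one_of_not_mem_relint hh hk hy.1 hy.2
    have hw : F.coord h hk y ≠ 0 := by
      intro h0; rw [h0, norm_zero] at h1; exact zero_ne_one h1
    have hgy : g y = B.G (b (F.param h hk (‖F.coord h hk y‖⁻¹ • F.coord h hk y)),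
        1 - ‖F.coord h hk y‖) := by simp [g, hw]
    rw [hgy, h1, inv_one, one_smul, Face.param_coord hh hy.1, sub_self]
    exact B.G_zero _ (hbK hy)
  · -- values
    intro y hy
    by_cases hw : F.coord h hk y = 0
    · have : g y = B.c := by simp [g, hw]
      rw [this]; exact hcmem
    · have hgy : g y = B.G (b (F.param h hk (‖F.coord h hk y‖⁻¹ • F.coord h hk y)),
          1 - ‖F.coord h hk y‖) := by simp [g, hw]
      rw [hgy]
      obtain ⟨h1, h2⟩ := hval y hy hw
      exact B.G_mem _ h1 _ h2

end Literature.AlgebraicTopology.Homotopy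

end
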